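import Summits.QuantumFields.YangMills.Theses.BalabanUVNodes
import Literature.MathematicalPhysics.QuantumFieldTheory.Balaban1983to89.Beta.AssemblyRemainder
import Literature.MathematicalPhysics.QuantumFieldTheory.Balaban1983to89.Beta.Drift
import Literature.Analysis.Convex.SchauderFixedPoint

/-!
# Crux `EndpointGivenB` (item stmt-QuantumFields-19181, route «BalabanUVNodes») — LINE «class-road»
# [2026-08-31 line-writer `linewriter-ym-nodeo-1` g0: REGISTRATION FORM — §7 appended (zero-hypothesis concluder `endpointGivenB_of_classRoadStubs`), `EndpointGivenB_of`'s binders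
#  typed by the registration names `Registered.stub_*`, and §8 appended = the AX EDITION (the same two stubs re-posed at the live pin's datum of record `Node00.datumOfRecord₁₃SepCoPHVAx`,
#  composed through this file's socket; the non-vacuous reading under hold E1); §1–§6 otherwise unchanged; authorship of the line: ym-nodeO-ideate LENS P3, 2026-08-25.]
## ym-nodeO-ideate · LENS P3 «weaken the target» · the CLASS-CURRENCY skeleton for NODE O's crux AS TYPED

The registered birth skeleton of this crux (pub-ymgap plan g59, `EndpointGivenB_birth.lean` sha16 7878f35ad0d905a8, evidence on
the item 2026-08-25T21:23:18Z) composes two stubs through `Beta.AssemblyRemainder.endpointExistence_of_limit_remainderConst`: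
its β-side binders are asked **BOX-WIDE** — the second-order remainder `Beta.RemainderChain.RemainderConst S γ₀ r`
(`|β¹_{k+1}(g_0,…,g_k)| ≤ r ≤ β⁰_∞∕4` for EVERY history in `]0,γ₀]^{k+1}`), the two-sided bound `−β′ ≤ β_{k+1} ≤ β′`
(`FlowStep.BetaUpperH` + lower) and joint continuity `FlowStep.BetaContH γ₀` on the whole history box — and the endpoint is reached
by FORWARD SHOOTING + the intermediate-value theorem (`EventualForm.endpointExistence`).

This file types the SAME crux's line in the currency in which print constructs anything at all: Bałaban's densities of
[III]–[V] (CMP 119 (1988) 243, (2.4)–(2.9) pp. 255–256; CMP 122 (1989) 175 and 355) exist for coupling sequences obeying the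
INTER-SCALE LAW (2.6) `1/g_m² ≤ 1/g_n² + β′(n − m)`, `g_m ≤ (1 + β₀) g_n` (m < n) — NOT for arbitrary histories in the box.
The two stubs below ask the one-loop DRIFT (history-free), the remainder bound `−r ≤ β¹ ≤ r′` with `r ≤ b` (NOT `≤ b∕4`) and the
continuity of `β_j` ONLY on the members of the inter-scale tube pinned at the target endpoint `g` (a compact convex sub-class of the
(2.6)-class, `running26_of_mem`), and NOTHING else on the β side (no `BetaUpperH`, no lower bound, no geometric rate of `β⁰_k`):
the endpoint is produced by a BROUWER FIXED POINT of the backward map `T(y)_k = 1/g² + Σ_{j∈[k,K)} β_j(g_0(y),…,g_j(y))` on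
that class (tree: `Literature.Analysis.Convex.exists_fixedPoint_of_mapsTo_isCompact`), whose fixed points are exactly the
solutions of (0.20) ending at `g_K = g`; forward generation (`D.fwd`, a FIELD of the datum) identifies the fixed point with a run of `D.C`.

CONTENTS.  §1–§3 the socket (re-declared verbatim from the cell's companion `memos/ROUTE-P3-Sketch.lean` v3.7 §B ∕ §B′ ∕ §E.8, farm rc 0,
where it has elaborated since 2026-08-24); §4 the two REGISTERED-SHAPE stubs `stub_classLawAtRecord`, `stub_classContAtRecord` (closed
∃ → ∃ form at the Stage-0 datum of record, exactly the shape of the birth skeleton) and the kernel-checked composition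
`EndpointGivenB_of : stub₁-statement → stub₂-statement → Summit.QuantumFields.YangMills.Theses.BalabanUVNodes.EndpointGivenB` BY NAME;
§5 WEAKER THAN THE BIRTH LINE, kernel-checked: the birth skeleton's stub conclusions imply these (`classLawAt_of_boxLawAt`,
`classContAt_of_boxContAt`; the drift constant is `c₀∕(1 − θ)`, `b = β⁰_∞`, `r′ = r`); §6 STRICTLY WEAKER at the level of β-families:
an explicit history family satisfying every β-side hypothesis of §4 while violating box-wide `RemainderConst` AND box-wide `BetaContH`
(`classRoad_strictly_weaker`) — the separation lives on the shell of histories that no inter-scale member visits.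

HONEST FRAMING.  Bookkeeping + [folklore] real analysis over the tree's typed carriers; NOTHING of Bałaban's is proved or asserted — every
walk- or β-hypothesis is a BINDER or a `stub_*`; sorries ONLY inside the two `stub_*`; [Balaban1987RG1] Thm 2 (p. 259) remains unproved in
print and here; finite-ε four-torus endpoint statement only; nothing continuum ∕ ℝ⁴ ∕ OS ∕ mass-gap ∕ Clay.  Print loci: [I] = CMP 109
(1987) 249: (0.17)–(0.20) pp. 255–256, Thm 2 p. 259, (1.3) p. 260, (1.19)–(1.22) + "C^∞-function of g_{j−1} ∈ [0,γ]" pp. 263–264;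
[III] = CMP 119 (1988) 243: (2.4)–(2.9) pp. 255–256.
-/

noncomputable section

namespace Summit.QuantumFields.YangMills.Cruxes.EndpointGivenB.ClassRoad

open Set Metric
open Literature.MathematicalPhysics.QuantumFieldTheory.Balaban1983to89
open Literature.MathematicalPhysics.QuantumFieldTheory.Balaban1983to89.FlowStep
open Literature.MathematicalPhysics.QuantumFieldTheory.Balaban1983to89.FlowStepRuns
open Literature.MathematicalPhysics.QuantumFieldTheory.Balaban1983to89.DagBinding
open Literature.MathematicalPhysics.QuantumFieldTheory.Balaban1983to89.Beta.Drift
open Literature.MathematicalPhysics.QuantumFieldTheory.Balaban1983to89.T4Continuum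

/-! ## §1  The backward map and tubes (companion `ROUTE-P3-Sketch.lean` §B, verbatim) -/

section Tube

open Finset

/-- Saturating index into `Fin (K+1)`. -/
def idx (K i : ℕ) : Fin (K + 1) := ⟨min i K, by omega⟩

theorem idx_val_of_le {K i : ℕ} (h : i ≤ K) : ((idx K i : Fin (K + 1)) : ℕ) = i := min_eq_left h

@[simp] theorem idx_fin {K : ℕ} (k : Fin (K + 1)) : idx K k = k :=
  Fin.ext (min_eq_left (Nat.le_of_lt_succ k.isLt))

/-- The couplings read off a point `y` of `ℝ^{K+1}` in the coordinates `y_k = 1/g_k²`. -/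
def cpl (K : ℕ) (y : Fin (K + 1) → ℝ) (i : ℕ) : ℝ := 1 / Real.sqrt (y (idx K i))

/-- **The backward map** `T(y)_k := 1/g² + Σ_{j∈[k,K)} β_j(g_0(y),…,g_j(y))`: its fixed points are exactly the solutions
of the history recursion (0.20) `RGEqH` ending at `g_K = g`. -/
def backMap (β : HBeta) (K : ℕ) (g : ℝ) (y : Fin (K + 1) → ℝ) : Fin (K + 1) → ℝ :=
  fun k => 1 / g ^ 2 + ∑ j ∈ Finset.Ico (k : ℕ) K, β j (prefixOf (cpl K y) j)

/-- A tube = a product of closed intervals in `ℝ^{K+1}`. -/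
def Tube (K : ℕ) (lo hi : Fin (K + 1) → ℝ) : Set (Fin (K + 1) → ℝ) :=
  Set.pi Set.univ fun k => Set.Icc (lo k) (hi k)

variable {β : HBeta} {K : ℕ} {lo hi : Fin (K + 1) → ℝ} {γ g : ℝ}

theorem mem_tube {y : Fin (K + 1) → ℝ} : y ∈ Tube K lo hi ↔ ∀ k, lo k ≤ y k ∧ y k ≤ hi k := by
  simp only [Tube, Set.mem_univ_pi, Set.mem_Icc]

theorem isCompact_tube : IsCompact (Tube K lo hi) := isCompact_univ_pi fun _ => isCompact_Icc

theorem convex_tube : Convex ℝ (Tube K lo hi) := convex_pi fun _ _ => convex_Icc _ _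

theorem tube_nonempty (h : ∀ k, lo k ≤ hi k) : (Tube K lo hi).Nonempty := ⟨lo, mem_tube.2 fun k => ⟨le_rfl, h k⟩⟩

theorem cpl_pos {y : Fin (K + 1) → ℝ} {i : ℕ} (h : 0 < y (idx K i)) : 0 < cpl K y i := by
  unfold cpl; have := Real.sqrt_pos.2 h; positivity

theorem inv_sq_cpl {y : Fin (K + 1) → ℝ} {i : ℕ} (h : 0 ≤ y (idx K i)) : 1 / (cpl K y i) ^ 2 = y (idx K i) := by
  unfold cpl; rw [div_pow, one_pow, Real.sq_sqrt h, one_div_one_div]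

theorem cpl_le {y : Fin (K + 1) → ℝ} {i : ℕ} (hγ : 0 < γ) (h : 1 / γ ^ 2 ≤ y (idx K i)) : cpl K y i ≤ γ := by
  unfold cpl
  have h1 : 1 / γ ≤ Real.sqrt (y (idx K i)) := by
    rw [show (1 : ℝ) / γ = Real.sqrt ((1 / γ) ^ 2) from (Real.sqrt_sq (by positivity)).symm]
    exact Real.sqrt_le_sqrt (by rw [div_pow, one_pow]; exact h)
  calc 1 / Real.sqrt (y (idx K i)) ≤ 1 / (1 / γ) := one_div_le_one_div_of_le (by positivity) h1
    _ = γ := one_div_one_div γ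

/-- Tube points with `1/γ² ≤ lo` read as histories in the box `]0,γ]`. -/
theorem prefix_cpl_mem_box {y : Fin (K + 1) → ℝ} (hγ : 0 < γ) (hlo : ∀ k, 1 / γ ^ 2 ≤ lo k)
    (hy : y ∈ Tube K lo hi) (j : ℕ) : prefixOf (cpl K y) j ∈ Box γ j := by
  rw [mem_box]; intro i
  have hyi : 1 / γ ^ 2 ≤ y (idx K i) := (hlo _).trans ((mem_tube.1 hy) _).1
  have hpos : 0 < y (idx K i) := lt_of_lt_of_le (by positivity) hyi
  exact ⟨cpl_pos hpos, cpl_le hγ hyi⟩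

/-- Lower envelope `1/g² + (b − r)(K − k) − 2A`. -/
def tubeLo (g b r A : ℝ) (K : ℕ) : Fin (K + 1) → ℝ := fun k => 1 / g ^ 2 + (b - r) * ((K : ℝ) - (k : ℕ)) - 2 * A

/-- Upper envelope `1/g² + (b + r′)(K − k) + 2A`. -/
def tubeHi (g b r' A : ℝ) (K : ℕ) : Fin (K + 1) → ℝ := fun k => 1 / g ^ 2 + (b + r') * ((K : ℝ) - (k : ℕ)) + 2 * A

/-- **THE AF TUBE at `(g, K)`**: histories whose inverse squared couplings run, up to the drift defect `2A` and the
remainder slacks `r, r′`, like the one-loop law BACKWARD from the endpoint: `1/g_k² ≈ 1/g² + b(K − k)`. -/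
abbrev AFTube (g b A r r' : ℝ) (K : ℕ) : Set (Fin (K + 1) → ℝ) := Tube K (tubeLo g b r A K) (tubeHi g b r' A K)

theorem tubeLo_ge {b r A : ℝ} (hgA : 1 / γ ^ 2 + 2 * A ≤ 1 / g ^ 2) (hbr : 0 ≤ b - r) (k : Fin (K + 1)) :
    1 / γ ^ 2 ≤ tubeLo g b r A K k := by
  have hk : ((k : ℕ) : ℝ) ≤ K := Nat.cast_le.2 (Nat.le_of_lt_succ k.isLt)
  have : 0 ≤ (b - r) * ((K : ℝ) - (k : ℕ)) := mul_nonneg hbr (sub_nonneg.2 hk)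
  simp only [tubeLo]; linarith

theorem tubeLo_le_hi {b r r' A : ℝ} (hA : 0 ≤ A) (hrr : 0 ≤ r + r') (k : Fin (K + 1)) :
    tubeLo g b r A K k ≤ tubeHi g b r' A K k := by
  have hk : ((k : ℕ) : ℝ) ≤ K := Nat.cast_le.2 (Nat.le_of_lt_succ k.isLt)
  have : 0 ≤ (r + r') * ((K : ℝ) - (k : ℕ)) := mul_nonneg hrr (sub_nonneg.2 hk)
  simp only [tubeLo, tubeHi]; nlinarith

/-! ## §2  The INTER-SCALE tube pinned at the target endpoint — a compact convex sub-class of the (2.6)-class (companion §B′, verbatim) -/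

/-- **THE INTER-SCALE TUBE at `(g, K)`**: `y_K = 1/g²` and, for all scales `m ≤ n ≤ K`,
`(b − r)(n − m) − 2A ≤ y_m − y_n ≤ (b + r′)(n − m) + 2A`. -/
def InterScaleTube (K : ℕ) (g b A r r' : ℝ) : Set (Fin (K + 1) → ℝ) :=
  {y | y (Fin.last K) = 1 / g ^ 2} ∩
    ⋂ (m : Fin (K + 1)) (n : Fin (K + 1)) (_ : m ≤ n),
      ({y | (b - r) * (((n : ℕ) : ℝ) - ((m : ℕ) : ℝ)) - 2 * A ≤ y m - y n} ∩
        {y | y m - y n ≤ (b + r') * (((n : ℕ) : ℝ) - ((m : ℕ) : ℝ)) + 2 * A})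

theorem mem_interScaleTube {y : Fin (K + 1) → ℝ} {b A r r' : ℝ} :
    y ∈ InterScaleTube K g b A r r' ↔ y (Fin.last K) = 1 / g ^ 2 ∧
      ∀ m n : Fin (K + 1), m ≤ n →
        (b - r) * (((n : ℕ) : ℝ) - ((m : ℕ) : ℝ)) - 2 * A ≤ y m - y n ∧
          y m - y n ≤ (b + r') * (((n : ℕ) : ℝ) - ((m : ℕ) : ℝ)) + 2 * A := by
  simp only [InterScaleTube, Set.mem_inter_iff, Set.mem_iInter, Set.mem_setOf_eq]

theorem isClosed_interScaleTube {b A r r' : ℝ} : IsClosed (InterScaleTube K g b A r r') := by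
  refine (isClosed_eq (continuous_apply _) continuous_const).inter ?_
  refine isClosed_iInter fun m => isClosed_iInter fun n => isClosed_iInter fun _ => ?_
  have hc : Continuous fun y : Fin (K + 1) → ℝ => y m - y n := (continuous_apply m).sub (continuous_apply n)
  exact (isClosed_le continuous_const hc).inter (isClosed_le hc continuous_const)

theorem convex_interScaleTube {b A r r' : ℝ} : Convex ℝ (InterScaleTube K g b A r r') := by
  have hl : ∀ m n : Fin (K + 1), IsLinearMap ℝ fun y : Fin (K + 1) → ℝ => y m - y n := fun m n =>
    { map_add := fun x z => by simp only [Pi.add_apply]; ring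
      map_smul := fun c x => by simp only [Pi.smul_apply, smul_eq_mul]; ring }
  have hp : IsLinearMap ℝ fun y : Fin (K + 1) → ℝ => y (Fin.last K) :=
    { map_add := fun x z => rfl, map_smul := fun c x => rfl }
  refine (convex_hyperplane hp _).inter ?_
  refine convex_iInter fun m => convex_iInter fun n => convex_iInter fun _ => ?_
  exact (convex_halfSpace_ge (hl m n) _).inter (convex_halfSpace_le (hl m n) _)

/-- The inter-scale tube lies in the AF tube (take `n = K`). -/
theorem interScaleTube_subset_afTube {b A r r' : ℝ} : InterScaleTube K g b A r r' ⊆ AFTube g b A r r' K := by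
  intro y hy
  obtain ⟨hpin, hrun⟩ := mem_interScaleTube.1 hy
  rw [mem_tube]
  intro k
  have h := hrun k (Fin.last K) (Fin.le_last k)
  rw [hpin, Fin.val_last] at h
  simp only [tubeLo, tubeHi]
  constructor <;> linarith [h.1, h.2]

theorem isCompact_interScaleTube {b A r r' : ℝ} : IsCompact (InterScaleTube K g b A r r') :=
  isCompact_tube.of_isClosed_subset isClosed_interScaleTube interScaleTube_subset_afTube

/-- The one-loop line `y_k = 1/g² + b(K − k)` is a member. -/
theorem oneLoopLine_mem {b A r r' : ℝ} (hA : 0 ≤ A) (hr : 0 ≤ r) (hr' : 0 ≤ r') :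
    (fun k : Fin (K + 1) => 1 / g ^ 2 + b * ((K : ℝ) - (k : ℕ))) ∈ InterScaleTube K g b A r r' := by
  refine mem_interScaleTube.2 ⟨?_, fun m n hmn => ?_⟩
  · simp only [Fin.val_last, sub_self, mul_zero, add_zero]
  · have hmn' : ((m : ℕ) : ℝ) ≤ ((n : ℕ) : ℝ) := Nat.cast_le.2 (Fin.le_def.1 hmn)
    constructor <;> nlinarith [mul_nonneg hr (sub_nonneg.2 hmn'), mul_nonneg hr' (sub_nonneg.2 hmn')]

theorem interScaleTube_nonempty {b A r r' : ℝ} (hA : 0 ≤ A) (hr : 0 ≤ r) (hr' : 0 ≤ r') :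
    (InterScaleTube K g b A r r').Nonempty := ⟨_, oneLoopLine_mem hA hr hr'⟩

/-- **PRINT'S (2.6) ON THE MEMBERS** ([III] p. 255), in the variables `y_k = 1/g_k²`: for `m < n`,
`y_m ≤ y_n + (b + r′ + 2A)(n − m)` (the upper running with `β′ = b + r′ + 2A`) and `y_n ≤ y_m + 2A` (near-monotonicity:
`g_m² ≤ (1 + 2A·g_m²)·g_n²`, i.e. `(1 + β₀)² = 1 + 2Aγ²` on `]0,γ]`), provided `r ≤ b`. -/
theorem running26_of_mem {y : Fin (K + 1) → ℝ} {b A r r' : ℝ} (hA : 0 ≤ A) (hbr : r ≤ b)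
    (hy : y ∈ InterScaleTube K g b A r r') {m n : Fin (K + 1)} (hmn : m < n) :
    y m ≤ y n + (b + r' + 2 * A) * (((n : ℕ) : ℝ) - ((m : ℕ) : ℝ)) ∧ y n ≤ y m + 2 * A := by
  have h := (mem_interScaleTube.1 hy).2 m n hmn.le
  have h1 : (1 : ℝ) ≤ ((n : ℕ) : ℝ) - ((m : ℕ) : ℝ) := by
    have := Fin.lt_def.1 hmn
    have : ((m : ℕ) : ℝ) + 1 ≤ ((n : ℕ) : ℝ) := by exact_mod_cast this
    linarith
  constructor <;> nlinarith [h.1, h.2, mul_nonneg (sub_nonneg.2 hbr) (by linarith : (0 : ℝ) ≤ ((n : ℕ) : ℝ) - ((m : ℕ) : ℝ))]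

/-- **(D4) ON THE INTER-SCALE TUBE**: `−r ≤ β¹_{k+1} ≤ r′` asked ONLY at histories read off members of the inter-scale
tubes — a sub-class of print's (2.6)-class (`running26_of_mem`). -/
def InterScaleRemainder (S : B12Beta.OneLoopSplit β) (γ b A r r' : ℝ) : Prop :=
  ∀ g : ℝ, 0 < g → 1 / γ ^ 2 + 2 * A ≤ 1 / g ^ 2 → ∀ (K : ℕ) (y : Fin (K + 1) → ℝ),
    y ∈ InterScaleTube K g b A r r' →
      ∀ k, k < K → -r ≤ S.β1 k (prefixOf (cpl K y) k) ∧ S.β1 k (prefixOf (cpl K y) k) ≤ r'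

/-- Invariance of the inter-scale tube under the backward map: drift of `β⁰` between ANY two scales
(`Drift.abs_sum_Ico_sub_le_of_drift`) + the remainder bounds on members. -/
theorem backMap_mapsTo_interScaleTube (S : B12Beta.OneLoopSplit β) {b A r r' : ℝ}
    (hdrift : OneLoopDrift b A S.β0)
    (hrem : ∀ y ∈ InterScaleTube K g b A r r', ∀ k, k < K →
      -r ≤ S.β1 k (prefixOf (cpl K y) k) ∧ S.β1 k (prefixOf (cpl K y) k) ≤ r') :
    MapsTo (backMap β K g) (InterScaleTube K g b A r r') (InterScaleTube K g b A r r') := by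
  intro y hy
  refine mem_interScaleTube.2 ⟨?_, fun m n hmn => ?_⟩
  · show 1 / g ^ 2 + ∑ j ∈ Finset.Ico ((Fin.last K : Fin (K + 1)) : ℕ) K, β j (prefixOf (cpl K y) j) = 1 / g ^ 2
    rw [Fin.val_last, Finset.Ico_self, Finset.sum_empty, add_zero]
  · have hmn' : (m : ℕ) ≤ (n : ℕ) := Fin.le_def.1 hmn
    have hnK : (n : ℕ) ≤ K := Nat.le_of_lt_succ n.isLt
    have hdiff : backMap β K g y m - backMap β K g y n
        = ∑ j ∈ Finset.Ico (m : ℕ) n, β j (prefixOf (cpl K y) j) := by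
      show (1 / g ^ 2 + ∑ j ∈ Finset.Ico (m : ℕ) K, β j (prefixOf (cpl K y) j))
          - (1 / g ^ 2 + ∑ j ∈ Finset.Ico (n : ℕ) K, β j (prefixOf (cpl K y) j)) = _
      rw [← Finset.sum_Ico_consecutive _ hmn' hnK]
      ring
    have hsplit : ∑ j ∈ Finset.Ico (m : ℕ) n, β j (prefixOf (cpl K y) j)
        = ∑ j ∈ Finset.Ico (m : ℕ) n, S.β0 j + ∑ j ∈ Finset.Ico (m : ℕ) n, S.β1 j (prefixOf (cpl K y) j) := by
      rw [← Finset.sum_add_distrib]; exact Finset.sum_congr rfl fun j _ => S.split j _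
    have hd := abs_le.mp (abs_sum_Ico_sub_le_of_drift hdrift hmn')
    have hlo1 : -r * (((n : ℕ) : ℝ) - ((m : ℕ) : ℝ))
        ≤ ∑ j ∈ Finset.Ico (m : ℕ) n, S.β1 j (prefixOf (cpl K y) j) := by
      have h := Finset.card_nsmul_le_sum (Finset.Ico (m : ℕ) n) (fun j => S.β1 j (prefixOf (cpl K y) j)) (-r)
        fun j hj => (hrem y hy j (lt_of_lt_of_le (Finset.mem_Ico.1 hj).2 hnK)).1
      rw [Nat.card_Ico, nsmul_eq_mul, Nat.cast_sub hmn'] at h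
      linarith
    have hhi1 : ∑ j ∈ Finset.Ico (m : ℕ) n, S.β1 j (prefixOf (cpl K y) j)
        ≤ r' * (((n : ℕ) : ℝ) - ((m : ℕ) : ℝ)) := by
      have h := Finset.sum_le_card_nsmul (Finset.Ico (m : ℕ) n) (fun j => S.β1 j (prefixOf (cpl K y) j)) r'
        fun j hj => (hrem y hy j (lt_of_lt_of_le (Finset.mem_Ico.1 hj).2 hnK)).2
      rw [Nat.card_Ico, nsmul_eq_mul, Nat.cast_sub hmn'] at h
      linarith
    rw [hdiff, hsplit]
    constructor <;> nlinarith [hd.1, hd.2, hlo1, hhi1]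

/-- `EndpointExistence` WITH THE RUN LOCATED: same quantifier prefix as `DagBinding.EndpointExistence` (:485), and the
tuned run's inverse squared couplings form a member of the inter-scale tube at `(g, K)` — so every downstream consumer
quantifying over the tuned runs (the spine slot `HybridNE7Under D (EndpointExistence …)` of the apex
`T4ContinuumYM4Torus.continuumYM4_torus_of_endpointExistence` :814) meets only (2.6)-class histories. -/
def EndpointExistenceWithin (C : B12.Construction) (b A r r' : ℝ) : Prop :=
  ∀ m : ℕ, ∃ γ₂ : ℝ, 0 < γ₂ ∧ ∀ γ : ℝ, 0 < γ → γ ≤ γ₂ →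
    ∃ gstar : ℝ, 0 < gstar ∧ ∀ g : ℝ, 0 < g → g ≤ gstar →
      ∀ K : ℕ, ∃ g0 : ℝ, (C ⟨K, m, g0⟩).flow.InInterval γ K ∧ (C ⟨K, m, g0⟩).flow.g K = g ∧
        (fun k : Fin (K + 1) => 1 / ((C ⟨K, m, g0⟩).flow.g k) ^ 2) ∈ InterScaleTube K g b A r r'

theorem endpointExistence_of_within {C : B12.Construction} {b A r r' : ℝ} (h : EndpointExistenceWithin C b A r r') :
    EndpointExistence C := by
  intro m
  obtain ⟨γ₂, hγ₂, H⟩ := h m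
  refine ⟨γ₂, hγ₂, fun γ hγ hγle => ?_⟩
  obtain ⟨gstar, hgstar, Hg⟩ := H γ hγ hγle
  refine ⟨gstar, hgstar, fun g hg hgle K => ?_⟩
  obtain ⟨g0, hI, hK, -⟩ := Hg g hg hgle K
  exact ⟨g0, hI, hK⟩

end Tube

/-! ## §3  (C) ON THE CLASS ONLY and the located END socket (companion §E.8, verbatim) -/

section ContOnClass

open Finset

variable {β : HBeta} {K : ℕ} {lo hi : Fin (K + 1) → ℝ} {γ g : ℝ}

/-- (C) ON A CLASS `T ⊆ ℝ^{K+1}`: `β_j` is continuous on the `j`-prefix coupling histories of the points of `T`, `j < K`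
(the only `β_j` the backward map at length `K` evaluates). -/
def BetaContOnClass (β : HBeta) (K : ℕ) (T : Set (Fin (K + 1) → ℝ)) : Prop :=
  ∀ j, j < K → ContinuousOn (β j) ((fun y : Fin (K + 1) → ℝ => prefixOf (cpl K y) j) '' T)

/-- Box-wide (C) gives (C) on every class inside a tube above `1/γ²`. -/
theorem betaContOnClass_of_betaContH (hγ : 0 < γ) (hlo : ∀ k, 1 / γ ^ 2 ≤ lo k) {T : Set (Fin (K + 1) → ℝ)}
    (hTsub : T ⊆ Tube K lo hi) (hcont : BetaContH γ β) : BetaContOnClass β K T := fun j _ =>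
  (hcont j).mono (by rintro _ ⟨y, hy, rfl⟩; exact prefix_cpl_mem_box hγ hlo (hTsub hy) j)

/-- The backward map is continuous on a class on whose prefix histories `β` is continuous. -/
theorem continuousOn_backMap_of_contOnClass (β : HBeta) (g : ℝ) (hγ : 0 < γ) (hlo : ∀ k, 1 / γ ^ 2 ≤ lo k)
    {T : Set (Fin (K + 1) → ℝ)} (hTsub : T ⊆ Tube K lo hi) (hcont : BetaContOnClass β K T) :
    ContinuousOn (backMap β K g) T := by
  apply continuousOn_pi.2
  intro k
  show ContinuousOn (fun y => 1 / g ^ 2 + ∑ j ∈ Finset.Ico (k : ℕ) K, β j (prefixOf (cpl K y) j)) _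
  refine continuousOn_const.add (continuousOn_finsetSum _ fun j hj => ?_)
  have hin : ContinuousOn (fun y : Fin (K + 1) → ℝ => prefixOf (cpl K y) j) T := by
    apply continuousOn_pi.2
    intro i
    show ContinuousOn (fun y : Fin (K + 1) → ℝ => 1 / Real.sqrt (y (idx K i))) T
    refine continuousOn_const.div ((continuous_apply (idx K (i : ℕ))).continuousOn.sqrt) fun y hy => ?_
    have hpos : 0 < y (idx K i) := lt_of_lt_of_le (by positivity) ((hlo _).trans ((mem_tube.1 (hTsub hy)) _).1)
    exact (Real.sqrt_pos.2 hpos).ne'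
  exact (hcont j (Finset.mem_Ico.1 hj).2).comp hin (Set.mapsTo_image _ _)

/-- **FIXED POINT ON AN INVARIANT COMPACT CONVEX CLASS, (C) ON THE CLASS ONLY** (as `exists_run_of_invariant` :484). -/
theorem exists_run_of_invariant_contOnClass (β : HBeta) (hg : 0 < g) (hγ : 0 < γ) {T : Set (Fin (K + 1) → ℝ)}
    (hTc : IsCompact T) (hTconv : Convex ℝ T) (hTne : T.Nonempty) (hTsub : T ⊆ Tube K lo hi)
    (hlo : ∀ k, 1 / γ ^ 2 ≤ lo k) (hcont : BetaContOnClass β K T) (hmaps : MapsTo (backMap β K g) T T) :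
    ∃ gs : ℕ → ℝ, gs K = g ∧ RGEqH K β gs ∧ Step.InInterval γ K gs ∧
      (fun k : Fin (K + 1) => 1 / gs k ^ 2) ∈ T := by
  obtain ⟨y, hy, hfix⟩ := Literature.Analysis.Convex.exists_fixedPoint_of_mapsTo_isCompact hTconv
    hTc.isClosed hTne hTc (continuousOn_backMap_of_contOnClass β g hγ hlo hTsub hcont) hmaps hmaps
  have hyT := mem_tube.1 (hTsub hy)
  have hypos : ∀ k, 0 < y k := fun k => lt_of_lt_of_le (by positivity) ((hlo k).trans (hyT k).1)
  have hfixn : ∀ n, n ≤ K → y (idx K n) = 1 / g ^ 2 + ∑ j ∈ Finset.Ico n K, β j (prefixOf (cpl K y) j) := by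
    intro n hn
    have h := (congrFun hfix (idx K n)).symm
    rw [h]
    show 1 / g ^ 2 + ∑ j ∈ Finset.Ico (min n K) K, β j (prefixOf (cpl K y) j) = _
    rw [min_eq_left hn]
  refine ⟨cpl K y, ?_, ?_, ?_, ?_⟩
  · have hK : y (idx K K) = 1 / g ^ 2 := by rw [hfixn K le_rfl, Finset.Ico_self, Finset.sum_empty, add_zero]
    show 1 / Real.sqrt (y (idx K K)) = g
    rw [hK, show (1 : ℝ) / g ^ 2 = (1 / g) ^ 2 by ring, Real.sqrt_sq (by positivity), one_div_one_div]
  · intro k hk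
    rw [inv_sq_cpl (hypos _).le, inv_sq_cpl (hypos _).le, hfixn k hk.le, hfixn (k + 1) hk,
      Finset.sum_eq_sum_Ico_succ_bot hk]
    ring
  · intro k _
    exact ⟨cpl_pos (hypos _), cpl_le hγ ((hlo _).trans (hyT _).1)⟩
  · have : (fun k : Fin (K + 1) => 1 / (cpl K y k) ^ 2) = y := by
      funext k; rw [inv_sq_cpl (hypos _).le, idx_fin]
    rw [this]; exact hy

/-- **(C) ON THE INTER-SCALE CLASSES** with box parameter `γ₀`: continuity of `β_j`, `j < K`, on the `j`-prefix histories of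
every admissibly pinned inter-scale tube (`1/g² ≥ 1/γ₀² + 2A`) — i.e. on the histories of `InterScaleMembers` (§C) and on
nothing else.  This is what the M-test of `Gaps.BetaContFromD4Chain` yields when the (D4) chain's uniform decay is available on
member histories only; box-wide (C) implies it (`betaContOnInterScale_of_betaContH`). -/
def BetaContOnInterScale (β : HBeta) (γ₀ b A r r' : ℝ) : Prop :=
  ∀ g : ℝ, 0 < g → 1 / γ₀ ^ 2 + 2 * A ≤ 1 / g ^ 2 → ∀ K : ℕ, BetaContOnClass β K (InterScaleTube K g b A r r')

theorem betaContOnInterScale_of_betaContH {γ₀ b A r r' : ℝ} (hγ₀ : 0 < γ₀) (hrb : r ≤ b) (hcont : BetaContH γ₀ β) :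
    BetaContOnInterScale β γ₀ b A r r' := fun _ _ hgA _ =>
  betaContOnClass_of_betaContH hγ₀ (tubeLo_ge hgA (sub_nonneg.2 hrb)) interScaleTube_subset_afTube hcont

/-- **THE LOCATED SOCKET WITH (C) ON THE CLASS ONLY**: `endpointExistenceWithin_of_interScaleRemainder` (:618) with the
box-wide binder B4 `BetaContH γ₀ β` replaced by `BetaContOnInterScale β γ₀ b A r r′` — so EVERY β-hypothesis of the socket
((D4) AND (C)) is asked on the inter-scale classes; box-wide remain only forward generation and the history-free drift (D1). -/
theorem endpointExistenceWithin_of_interScaleRemainder_contOn {C : B12.Construction} {β : HBeta}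
    (hgen : ForwardGenerated C β) (S : B12Beta.OneLoopSplit β) {γ₀ b A r r' : ℝ} (hγ₀ : 0 < γ₀) (h0r : 0 ≤ r)
    (hrb : r ≤ b) (h0r' : 0 ≤ r') (hdrift : OneLoopDrift b A S.β0) (hcont : BetaContOnInterScale β γ₀ b A r r')
    (hrem : InterScaleRemainder S γ₀ b A r r') : EndpointExistenceWithin C b A r r' := by
  have hA : 0 ≤ A := hdrift.nonneg
  intro m
  refine ⟨γ₀, hγ₀, fun γ hγ hγle => ?_⟩
  set gstar : ℝ := 1 / Real.sqrt (1 / γ ^ 2 + 2 * A) with hgstar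
  have hgstar_pos : 0 < gstar := by positivity
  refine ⟨gstar, hgstar_pos, fun g hg hgle K => ?_⟩
  have hgs : 1 / gstar ^ 2 = 1 / γ ^ 2 + 2 * A := by
    rw [hgstar, div_pow, one_pow, Real.sq_sqrt (by positivity), one_div_one_div]
  have hgM : 1 / γ ^ 2 + 2 * A ≤ 1 / g ^ 2 := by
    rw [← hgs]; exact one_div_le_one_div_of_le (by positivity) (pow_le_pow_left₀ hg.le hgle 2)
  have hγγ₀ : 1 / γ₀ ^ 2 ≤ 1 / γ ^ 2 := one_div_le_one_div_of_le (by positivity) (pow_le_pow_left₀ hγ.le hγle 2)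
  have hgM₀ : 1 / γ₀ ^ 2 + 2 * A ≤ 1 / g ^ 2 := by linarith
  have hlo : ∀ k, 1 / γ ^ 2 ≤ tubeLo g b r A K k := tubeLo_ge hgM (sub_nonneg.2 hrb)
  have hcont' : BetaContOnClass β K (InterScaleTube K g b A r r') := hcont g hg hgM₀ K
  have hmaps := backMap_mapsTo_interScaleTube (g := g) (K := K) S hdrift
    (fun y hy k hk => hrem g hg hgM₀ K y hy k hk)
  obtain ⟨gs, hgsK, hrg, hI, hmem⟩ := exists_run_of_invariant_contOnClass β hg hγ isCompact_interScaleTube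
    convex_interScaleTube (interScaleTube_nonempty hA h0r h0r') interScaleTube_subset_afTube hlo hcont' hmaps
  have heq : ∀ k, k ≤ K → (C ⟨K, m, gs 0⟩).flow.g k = gs k :=
    flow_eq_of_rgEqH (C ⟨K, m, gs 0⟩).flow β K (fun k hk => hgen.2 ⟨K, m, gs 0⟩ k hk)
      (hgen.1 ⟨K, m, gs 0⟩) hrg (fun k hk => (hI k hk).1)
  refine ⟨gs 0, fun k hk => ?_, ?_, ?_⟩
  · rw [heq k hk]; exact hI k hk
  · rw [heq K le_rfl]; exact hgsK
  · have : (fun k : Fin (K + 1) => 1 / ((C ⟨K, m, gs 0⟩).flow.g k) ^ 2) = fun k : Fin (K + 1) => 1 / gs k ^ 2 := by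
      funext k; rw [heq k (Nat.le_of_lt_succ k.isLt)]
    rw [this]; exact hmem

/-- `DagBinding.EndpointExistence` from (D4) AND (C) on the inter-scale classes. -/
theorem endpointExistence_of_interScaleRemainder_contOn {C : B12.Construction} {β : HBeta}
    (hgen : ForwardGenerated C β) (S : B12Beta.OneLoopSplit β) {γ₀ b A r r' : ℝ} (hγ₀ : 0 < γ₀) (h0r : 0 ≤ r)
    (hrb : r ≤ b) (h0r' : 0 ≤ r') (hdrift : OneLoopDrift b A S.β0) (hcont : BetaContOnInterScale β γ₀ b A r r')
    (hrem : InterScaleRemainder S γ₀ b A r r') : EndpointExistence C :=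
  endpointExistence_of_within (endpointExistenceWithin_of_interScaleRemainder_contOn hgen S hγ₀ h0r hrb h0r' hdrift hcont hrem)

end ContOnClass

/-! ## §4  THE LINE: the crux's two stubs in CLASS currency and the kernel-checked composition to the crux BY NAME

Shape = the birth skeleton's (closed `∃ → ∃` statements at the Stage-0 datum of record, stub 2 chained after stub 1), so a
`ledger skeleton check … --crux stmt-QuantumFields-19181` registers them like the birth line's.  What differs is ONLY the β-side law:
`ClassLaw` (drift + (D4) on the pinned inter-scale classes, `0 ≤ r ≤ b`, `0 ≤ r′`) replaces `OneLoopLaw` (geometric one-loop rate,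
box-wide `RemainderConst` with `r ≤ β⁰_∞∕4`, box-wide `BetaUpperH` and lower bound), and `ClassCont` ((C) on the classes) replaces
box-wide `BetaContH`. -/

section Line

local notation "SU2" => Matrix.specialUnitaryGroup (Fin 2) ℂ

/-- Rung-1 body = the hypothesis of the crux (verbatim the birth skeleton's `RungB`): Stage-0 datum of record, (B) as printed,
runs in every small window. -/
def RungB {F : T4Family} (D : FiniteEpsData F SU2) : Prop :=
  Node00.IsDatumOfRecord₀ F 2 D ∧ B16.EndStatementBPrinted D.C ∧
    ∃ γ₁ : ℝ, 0 < γ₁ ∧ ∀ γ : ℝ, 0 < γ → γ ≤ γ₁ → ∃ P : B12.RunParams, (D.C P).flow.InInterval γ P.K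

/-- **THE CLASS LAW** of the datum's history-dependent β-family `D.βfun` with data `(γ₀, b, A, r, r′)` and a one-loop split `S`
(`β_{k+1} = β⁰_{k+1} + β¹_{k+1}(g_0,…,g_k)`, `β¹ = 0` at `g_k = 0` — [Balaban1987RG1] (1.19)–(1.22) p. 264): the history-free
DRIFT `|Σ_{j<k} β⁰_j − b k| ≤ A` (implied by any summable convergence `β⁰_k → b`, in particular by the birth line's geometric rate),
and the second-order remainder `−r ≤ β¹_{k+1} ≤ r′` asked ONLY at the prefix histories of members of the inter-scale tube pinned at
each admissible target `g` (`1/g² ≥ 1/γ₀² + 2A`), with `0 ≤ r ≤ b`, `0 ≤ r′` (NOT `r ≤ b∕4`; one-sided pair; no β upper∕lower bound). -/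
def ClassLaw {F : T4Family} (D : FiniteEpsData F SU2) (S : B12Beta.OneLoopSplit D.βfun) (γ₀ b A r r' : ℝ) : Prop :=
  0 < γ₀ ∧ 0 ≤ r ∧ r ≤ b ∧ 0 ≤ r' ∧ OneLoopDrift b A S.β0 ∧ InterScaleRemainder S γ₀ b A r r'

/-- **(C) ON THE CLASS** for the datum's β-family: continuity of `β_j` (`j < K`) on the `j`-prefix histories of the members of every
admissibly pinned inter-scale tube — and nowhere else. -/
def ClassCont {F : T4Family} (D : FiniteEpsData F SU2) (γ₀ b A r r' : ℝ) : Prop :=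
  BetaContOnInterScale D.βfun γ₀ b A r r'

/-- STUB 1 «class law at a datum of record satisfying (B)»: one-loop drift + (D4) on the pinned inter-scale classes (the image of
NODE O restricted to member histories, through NODE A → NODE B → the (D4) slice `Gaps/D4ScaleSlice` pointwise in `(k, p)`).  Size L. -/
theorem stub_classLawAtRecord :
    ∀ F : T4Family, (∃ D : FiniteEpsData F SU2, RungB D) →
      ∃ (D : FiniteEpsData F SU2) (S : B12Beta.OneLoopSplit D.βfun) (γ₀ b A r r' : ℝ),
        RungB D ∧ ClassLaw D S γ₀ b A r r' := by
  sorry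

/-- STUB 2 «(C) on the class at that datum»: continuity of the β-family on the member histories only (the class-phrased M-test over
the same (D4) chain, companion §E.9).  Size M. -/
theorem stub_classContAtRecord :
    ∀ F : T4Family, (∃ (D : FiniteEpsData F SU2) (S : B12Beta.OneLoopSplit D.βfun) (γ₀ b A r r' : ℝ),
        RungB D ∧ ClassLaw D S γ₀ b A r r') →
      ∃ (D : FiniteEpsData F SU2) (S : B12Beta.OneLoopSplit D.βfun) (γ₀ b A r r' : ℝ),
        RungB D ∧ ClassLaw D S γ₀ b A r r' ∧ ClassCont D γ₀ b A r r' := by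
  sorry

/-- REGISTRATION NAMES (line-writer seat `linewriter-ym-nodeo-1` g0, 2026-08-31; additive): the two stub STATEMENTS verbatim as reducible abbreviations NAMED LIKE THE STUBS,
so that every theorem of this file concluding the crux BY NAME has only ADMISSIBLE hypotheses for `#h21_check_skeleton` (rule (ii): registered obligations ∕ declared stubs,
matched by name) — the device of the porter's `pta_residueW.lean` (`__Registered`).  Statement of stub 1. -/
abbrev Registered.stub_classLawAtRecord : Prop :=
  ∀ F : T4Family, (∃ D : FiniteEpsData F SU2, RungB D) →
      ∃ (D : FiniteEpsData F SU2) (S : B12Beta.OneLoopSplit D.βfun) (γ₀ b A r r' : ℝ),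
        RungB D ∧ ClassLaw D S γ₀ b A r r'

/-- Statement of stub 2 (registration name, see `Registered.stub_classLawAtRecord`). -/
abbrev Registered.stub_classContAtRecord : Prop :=
  ∀ F : T4Family, (∃ (D : FiniteEpsData F SU2) (S : B12Beta.OneLoopSplit D.βfun) (γ₀ b A r r' : ℝ),
        RungB D ∧ ClassLaw D S γ₀ b A r r') →
      ∃ (D : FiniteEpsData F SU2) (S : B12Beta.OneLoopSplit D.βfun) (γ₀ b A r r' : ℝ),
        RungB D ∧ ClassLaw D S γ₀ b A r r' ∧ ClassCont D γ₀ b A r r'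

/-- sanity (kernel): the registration names ARE the stub statements. -/
example : Registered.stub_classLawAtRecord ∧ Registered.stub_classContAtRecord ↔
    ((∀ F : T4Family, (∃ D : FiniteEpsData F SU2, RungB D) →
      ∃ (D : FiniteEpsData F SU2) (S : B12Beta.OneLoopSplit D.βfun) (γ₀ b A r r' : ℝ),
        RungB D ∧ ClassLaw D S γ₀ b A r r') ∧
     (∀ F : T4Family, (∃ (D : FiniteEpsData F SU2) (S : B12Beta.OneLoopSplit D.βfun) (γ₀ b A r r' : ℝ),
        RungB D ∧ ClassLaw D S γ₀ b A r r') →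
      ∃ (D : FiniteEpsData F SU2) (S : B12Beta.OneLoopSplit D.βfun) (γ₀ b A r r' : ℝ),
        RungB D ∧ ClassLaw D S γ₀ b A r r' ∧ ClassCont D γ₀ b A r r')) := Iff.rfl

/-- **THE COMPOSITION** (kernel-checked, no sorry): stub 1 → stub 2 → the crux `EndpointGivenB` BY NAME, through the located socket
`endpointExistence_of_interScaleRemainder_contOn` (Brouwer on the pinned inter-scale class), forward generation from the datum's
own field `D.fwd`.  No `BetaUpperH`, no lower β-bound, no box-wide (D4), no box-wide (C), no rate of `β⁰_k` is consumed. -/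
theorem EndpointGivenB_of
    (h₁ : Registered.stub_classLawAtRecord)
    (h₂ : Registered.stub_classContAtRecord) :
    Summit.QuantumFields.YangMills.Theses.BalabanUVNodes.EndpointGivenB := by
  intro F hF
  obtain ⟨D, S, γ₀, b, A, r, r', ⟨h0, hB, -⟩, ⟨hγ₀, h0r, hrb, h0r', hdrift, hrem⟩, hcont⟩ := h₂ F (h₁ F hF)
  exact ⟨D, h0, hB, endpointExistence_of_interScaleRemainder_contOn D.fwd S hγ₀ h0r hrb h0r' hdrift hcont hrem⟩

/-- THE LOCATED FORM for the spine's consumer (item `SpineGivenEndpoint` quantifies over the tuned runs): the same two stubs give a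
datum of record with (B) whose endpoint runs are MEMBERS of the pinned inter-scale classes (`EndpointExistenceWithin`), so every
downstream ∀ over tuned runs meets (2.6)-class histories only (companion §D.3 ∕ §E.6). -/
theorem endpointWithin_of
    (h₁ : ∀ F : T4Family, (∃ D : FiniteEpsData F SU2, RungB D) →
      ∃ (D : FiniteEpsData F SU2) (S : B12Beta.OneLoopSplit D.βfun) (γ₀ b A r r' : ℝ),
        RungB D ∧ ClassLaw D S γ₀ b A r r')
    (h₂ : ∀ F : T4Family, (∃ (D : FiniteEpsData F SU2) (S : B12Beta.OneLoopSplit D.βfun) (γ₀ b A r r' : ℝ),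
        RungB D ∧ ClassLaw D S γ₀ b A r r') →
      ∃ (D : FiniteEpsData F SU2) (S : B12Beta.OneLoopSplit D.βfun) (γ₀ b A r r' : ℝ),
        RungB D ∧ ClassLaw D S γ₀ b A r r' ∧ ClassCont D γ₀ b A r r') :
    ∀ F : T4Family, (∃ D : FiniteEpsData F SU2, RungB D) →
      ∃ (D : FiniteEpsData F SU2) (b A r r' : ℝ),
        RungB D ∧ EndpointExistenceWithin D.C.toB12 b A r r' := by
  intro F hF
  obtain ⟨D, S, γ₀, b, A, r, r', hR, ⟨hγ₀, h0r, hrb, h0r', hdrift, hrem⟩, hcont⟩ := h₂ F (h₁ F hF)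
  exact ⟨D, b, A, r, r', hR, endpointExistenceWithin_of_interScaleRemainder_contOn D.fwd S hγ₀ h0r hrb h0r' hdrift hcont hrem⟩

end Line

/-! ## §5  WEAKER THAN THE BIRTH LINE (kernel-checked): the birth skeleton's stub conclusions imply this line's -/

section VersusBirth

local notation "SU2" => Matrix.specialUnitaryGroup (Fin 2) ℂ

variable {β : HBeta}

/-- The birth skeleton's box-wide ONE-LOOP LAW, verbatim (pub-ymgap plan g59, `EndpointGivenB_birth.lean` sha16 7878f35ad0d905a8):
(AF-0∞) `β⁰_∞ > 0`, (AF-0r) `|β⁰_{k+1} − β⁰_∞| ≤ c₀θ^k`, `RemainderConst S γ₀ r` on the whole history box with `r ≤ β⁰_∞∕4`,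
`BetaUpperH β′` and `−β′ ≤ β` box-wide. -/
def OneLoopLaw {F : T4Family} (D : FiniteEpsData F SU2) (S : B12Beta.OneLoopSplit D.βfun) (γ₀ binf c₀ θ r β' : ℝ) : Prop :=
  0 < γ₀ ∧ 0 < binf ∧ 0 ≤ c₀ ∧ 0 ≤ θ ∧ θ < 1 ∧ (∀ k, |S.β0 k - binf| ≤ c₀ * θ ^ k) ∧
    Beta.RemainderChain.RemainderConst S γ₀ r ∧ r ≤ binf / 4 ∧ FlowStep.BetaUpperH β' γ₀ D.βfun ∧
      ∀ k, ∀ v ∈ FlowStep.Box γ₀ k, -β' ≤ D.βfun k v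

/-- (AF-0r) ⇒ DRIFT: a geometric rate `|β⁰_k − β⁰_∞| ≤ c₀θ^k` gives `|Σ_{j<k} β⁰_j − β⁰_∞ k| ≤ c₀/(1 − θ)` for every `k`
(any SUMMABLE rate would do; the drift is all the backward map consumes of the one-loop side). [folklore] -/
theorem oneLoopDrift_of_geometric {β0 : ℕ → ℝ} {binf c₀ θ : ℝ} (hc₀ : 0 ≤ c₀) (hθ0 : 0 ≤ θ) (hθ1 : θ < 1)
    (hconv : ∀ k, |β0 k - binf| ≤ c₀ * θ ^ k) : OneLoopDrift binf (c₀ / (1 - θ)) β0 := by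
  intro k
  have hgeom : ∑ j ∈ Finset.range k, θ ^ j ≤ (1 - θ)⁻¹ :=
    sum_le_hasSum (Finset.range k) (fun j _ => pow_nonneg hθ0 j) (hasSum_geometric_of_lt_one hθ0 hθ1)
  have h1 : ∑ j ∈ Finset.range k, β0 j - binf * k = ∑ j ∈ Finset.range k, (β0 j - binf) := by
    rw [Finset.sum_sub_distrib, Finset.sum_const, Finset.card_range, nsmul_eq_mul]; ring
  rw [h1]
  calc |∑ j ∈ Finset.range k, (β0 j - binf)| ≤ ∑ j ∈ Finset.range k, |β0 j - binf| := Finset.abs_sum_le_sum_abs _ _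
    _ ≤ ∑ j ∈ Finset.range k, c₀ * θ ^ j := Finset.sum_le_sum fun j _ => hconv j
    _ = c₀ * ∑ j ∈ Finset.range k, θ ^ j := (Finset.mul_sum _ _ _).symm
    _ ≤ c₀ * (1 - θ)⁻¹ := mul_le_mul_of_nonneg_left hgeom hc₀
    _ = c₀ / (1 - θ) := (div_eq_mul_inv _ _).symm

/-- Box-wide `RemainderConst S γ₀ r` ⇒ (D4) on the pinned inter-scale classes with `r′ = r` (members' prefix histories lie in the
box `]0,γ₀]` when `r ≤ b`). -/
theorem interScaleRemainder_of_remainderConst (S : B12Beta.OneLoopSplit β) {γ₀ b A r : ℝ} (hγ₀ : 0 < γ₀) (hrb : r ≤ b)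
    (hrem : Beta.RemainderChain.RemainderConst S γ₀ r) : InterScaleRemainder S γ₀ b A r r := by
  intro g _ hgA K y hy k _
  have hmem : prefixOf (cpl K y) k ∈ Box γ₀ k :=
    prefix_cpl_mem_box hγ₀ (tubeLo_ge hgA (sub_nonneg.2 hrb)) (interScaleTube_subset_afTube hy) k
  exact abs_le.1 (hrem k _ fun i => (mem_box.1 hmem) i)

/-- A box-wide remainder bound forces `0 ≤ r` (the box is nonempty). -/
theorem remainderConst_nonneg (S : B12Beta.OneLoopSplit β) {γ₀ r : ℝ} (hγ₀ : 0 < γ₀)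
    (hrem : Beta.RemainderChain.RemainderConst S γ₀ r) : 0 ≤ r :=
  (abs_nonneg _).trans (hrem 0 (fun _ => γ₀) fun _ => ⟨hγ₀, le_rfl⟩)

/-- **THE BIRTH LINE'S LAW ⇒ THE CLASS LAW**, with `b = β⁰_∞`, `A = c₀/(1 − θ)`, `r′ = r`; the birth line's `BetaUpperH`, lower
bound and `r ≤ β⁰_∞∕4` (beyond `r ≤ β⁰_∞`) are simply NOT USED. -/
theorem classLaw_of_oneLoopLaw {F : T4Family} (D : FiniteEpsData F SU2) (S : B12Beta.OneLoopSplit D.βfun)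
    {γ₀ binf c₀ θ r β' : ℝ} (h : OneLoopLaw D S γ₀ binf c₀ θ r β') : ClassLaw D S γ₀ binf (c₀ / (1 - θ)) r r := by
  obtain ⟨hγ₀, hbinf, hc₀, hθ0, hθ1, hconv, hrem, hr, -, -⟩ := h
  have h0r : 0 ≤ r := remainderConst_nonneg S hγ₀ hrem
  have hrb : r ≤ binf := hr.trans (by linarith)
  exact ⟨hγ₀, h0r, hrb, h0r, oneLoopDrift_of_geometric hc₀ hθ0 hθ1 hconv,
    interScaleRemainder_of_remainderConst S hγ₀ hrb hrem⟩

/-- **THE BIRTH LINE'S (C) ⇒ (C) ON THE CLASS.** -/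
theorem classCont_of_betaContH {F : T4Family} (D : FiniteEpsData F SU2) {γ₀ b A r r' : ℝ} (hγ₀ : 0 < γ₀) (hrb : r ≤ b)
    (hcont : FlowStep.BetaContH γ₀ D.βfun) : ClassCont D γ₀ b A r r' :=
  betaContOnInterScale_of_betaContH hγ₀ hrb hcont

/-- **THE BIRTH SKELETON'S TWO STUBS IMPLY THIS LINE'S TWO STUBS, jointly**: whatever closes `stub_oneLoopLawAtRecord` and
`stub_betaContAtRecord` (birth line) closes `stub_classLawAtRecord` and `stub_classContAtRecord` (this line) — with the same datum,
the same split, `b = β⁰_∞`, `A = c₀/(1 − θ)`, `r′ = r`. -/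
theorem classStubs_of_birthStubs
    (b₁ : ∀ F : T4Family, (∃ D : FiniteEpsData F SU2, RungB D) →
      ∃ (D : FiniteEpsData F SU2) (S : B12Beta.OneLoopSplit D.βfun) (γ₀ binf c₀ θ r β' : ℝ),
        RungB D ∧ OneLoopLaw D S γ₀ binf c₀ θ r β')
    (b₂ : ∀ F : T4Family, (∃ (D : FiniteEpsData F SU2) (S : B12Beta.OneLoopSplit D.βfun) (γ₀ binf c₀ θ r β' : ℝ),
        RungB D ∧ OneLoopLaw D S γ₀ binf c₀ θ r β') →
      ∃ (D : FiniteEpsData F SU2) (S : B12Beta.OneLoopSplit D.βfun) (γ₀ binf c₀ θ r β' : ℝ),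
        RungB D ∧ OneLoopLaw D S γ₀ binf c₀ θ r β' ∧ FlowStep.BetaContH γ₀ D.βfun) :
    (∀ F : T4Family, (∃ D : FiniteEpsData F SU2, RungB D) →
      ∃ (D : FiniteEpsData F SU2) (S : B12Beta.OneLoopSplit D.βfun) (γ₀ b A r r' : ℝ),
        RungB D ∧ ClassLaw D S γ₀ b A r r') ∧
    (∀ F : T4Family, (∃ D : FiniteEpsData F SU2, RungB D) →
      ∃ (D : FiniteEpsData F SU2) (S : B12Beta.OneLoopSplit D.βfun) (γ₀ b A r r' : ℝ),
        RungB D ∧ ClassLaw D S γ₀ b A r r' ∧ ClassCont D γ₀ b A r r') := by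
  refine ⟨fun F hF => ?_, fun F hF => ?_⟩
  · obtain ⟨D, S, γ₀, binf, c₀, θ, r, β', hR, hL⟩ := b₁ F hF
    exact ⟨D, S, γ₀, binf, c₀ / (1 - θ), r, r, hR, classLaw_of_oneLoopLaw D S hL⟩
  · obtain ⟨D, S, γ₀, binf, c₀, θ, r, β', hR, hL, hC⟩ := b₂ F (b₁ F hF)
    have hcl := classLaw_of_oneLoopLaw D S hL
    exact ⟨D, S, γ₀, binf, c₀ / (1 - θ), r, r, hR, hcl, classCont_of_betaContH D hcl.1 hcl.2.2.1 hC⟩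

end VersusBirth

/-! ## §6  STRICTLY WEAKER at the level of β-families: a family with the class law and (C) on the class that violates the
birth line's box-wide `RemainderConst` (for every `r < 1 = b`, so a fortiori for `r ≤ b∕4`) AND box-wide `BetaContH`.
The separation lives on the SHELL `1/g_0² < 1/γ₀² + A` of histories that no inter-scale member pinned at `1/g² ≥ 1/γ₀² + 2A`
visits (`γ₀ = b = 1`, `A = 1/2`, `r = r′ = 1/4`).  It separates the BINDERS; it says nothing about Bałaban's β-family. -/

section Separation

open Classical in
/-- The separating family: `β⁰ ≡ 1`; `β¹_{k+1}(g_0,…,g_k) = 1` on the shell `1/g_0² < 3/2` (switched off at `g_k = 0`, the printed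
vanishing), `= 0` elsewhere. -/
def βsep : HBeta := fun k p => 1 + (if 1 / (p 0) ^ 2 < 3 / 2 ∧ p (Fin.last k) ≠ 0 then 1 else 0)

open Classical in
/-- Its one-loop split. -/
def Ssep : B12Beta.OneLoopSplit βsep where
  β0 := fun _ => 1
  β1 := fun k p => if 1 / (p 0) ^ 2 < 3 / 2 ∧ p (Fin.last k) ≠ 0 then 1 else 0
  split := fun _ _ => rfl
  vanish := fun k p hp => by simp [hp]

theorem oneLoopDrift_sep : OneLoopDrift 1 (1 / 2) Ssep.β0 := by
  intro k
  simp [Ssep]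

/-- Members of an inter-scale tube pinned at `1/g² ≥ 2` (parameters `b = 1`, `A = 1/2`, `r = r′ = 1/4`) of length `K ≥ 1` have
`1/g_0² ≥ 7/4`: they never visit the shell. -/
theorem sep_member_first {K : ℕ} {g : ℝ} {y : Fin (K + 1) → ℝ} (hg2 : 2 ≤ 1 / g ^ 2)
    (hy : y ∈ InterScaleTube K g 1 (1 / 2) (1 / 4) (1 / 4)) (hK : 1 ≤ K) : 7 / 4 ≤ y (idx K 0) := by
  obtain ⟨hpin, hrun⟩ := mem_interScaleTube.1 hy
  have h := (hrun (idx K 0) (Fin.last K) (Fin.le_last _)).1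
  rw [hpin, Fin.val_last, idx_val_of_le (Nat.zero_le K)] at h
  have hK' : (1 : ℝ) ≤ (K : ℝ) := by exact_mod_cast hK
  push_cast at h
  linarith

theorem Ssep_β1_member {K : ℕ} {g : ℝ} {y : Fin (K + 1) → ℝ} (hg2 : 2 ≤ 1 / g ^ 2)
    (hy : y ∈ InterScaleTube K g 1 (1 / 2) (1 / 4) (1 / 4)) {k : ℕ} (hk : k < K) :
    Ssep.β1 k (prefixOf (cpl K y) k) = 0 := by
  have h74 := sep_member_first hg2 hy (by omega)
  have hy0 : 0 ≤ y (idx K 0) := by linarith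
  have hval : prefixOf (cpl K y) k 0 = cpl K y 0 := by simp [prefixOf]
  have hnot : ¬ (1 / (prefixOf (cpl K y) k 0) ^ 2 < 3 / 2 ∧ prefixOf (cpl K y) k (Fin.last k) ≠ 0) := by
    rintro ⟨hlt, -⟩
    rw [hval, inv_sq_cpl hy0] at hlt
    linarith
  dsimp only [Ssep]
  exact if_neg hnot

/-- (D4) ON THE CLASS holds for the separating family (with `β¹ = 0` on every member history). -/
theorem interScaleRemainder_sep : InterScaleRemainder Ssep 1 1 (1 / 2) (1 / 4) (1 / 4) := by
  intro g _ hgA K y hy k hk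
  have hg2 : 2 ≤ 1 / g ^ 2 := by norm_num at hgA ⊢; exact hgA
  rw [Ssep_β1_member hg2 hy hk]
  norm_num

/-- (C) ON THE CLASS holds for the separating family (it is constant `= 1` on every member history). -/
theorem betaContOnInterScale_sep : BetaContOnInterScale βsep 1 1 (1 / 2) (1 / 4) (1 / 4) := by
  intro g _ hgA K j hj
  have hg2 : 2 ≤ 1 / g ^ 2 := by norm_num at hgA ⊢; exact hgA
  refine (continuousOn_const (c := (1 : ℝ))).congr ?_
  rintro _ ⟨y, hy, rfl⟩
  show βsep j (prefixOf (cpl K y) j) = 1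
  have h : βsep j (prefixOf (cpl K y) j) = 1 + Ssep.β1 j (prefixOf (cpl K y) j) := Ssep.split j _
  rw [h, Ssep_β1_member hg2 hy hj, add_zero]

/-- … but the box-wide remainder bound FAILS for every `r < 1` (the history `g_0 = 1` of length one lies in the box `]0,1]` and on
the shell), so in particular the birth line's `r ≤ β⁰_∞∕4 = 1/4` is violated … -/
theorem not_remainderConst_sep {r : ℝ} (hr : r < 1) : ¬ Beta.RemainderChain.RemainderConst Ssep 1 r := by
  intro h
  have h1 := h 0 (fun _ => (1 : ℝ)) fun _ => ⟨one_pos, le_rfl⟩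
  have hval : Ssep.β1 0 (fun _ => (1 : ℝ)) = 1 := by
    dsimp only [Ssep]
    exact if_pos ⟨by norm_num, by norm_num⟩
  rw [hval, abs_one] at h1
  linarith

/-- … and box-wide (C) FAILS (`β_1` jumps across `g_0 = √(2/3)` inside the box `]0,1]`). -/
theorem not_betaContH_sep : ¬ FlowStep.BetaContH 1 βsep := by
  intro h
  set t : ℝ := Real.sqrt (2 / 3) with ht
  have ht0 : 0 < t := Real.sqrt_pos.2 (by norm_num)
  have ht2 : t ^ 2 = 2 / 3 := Real.sq_sqrt (by norm_num)
  have ht1 : t ≤ 1 := by nlinarith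
  have hbt : (fun _ : Fin 1 => t) ∈ Box 1 0 := mem_box.2 fun _ => ⟨ht0, ht1⟩
  have hft : βsep 0 (fun _ => t) = 1 := by
    have hn : ¬ (1 / t ^ 2 < 3 / 2 ∧ (fun _ : Fin 1 => t) (Fin.last 0) ≠ 0) := by
      rintro ⟨hlt, -⟩; rw [ht2] at hlt; norm_num at hlt
    show 1 + (if 1 / t ^ 2 < 3 / 2 ∧ (fun _ : Fin 1 => t) (Fin.last 0) ≠ 0 then (1 : ℝ) else 0) = 1
    rw [if_neg hn, add_zero]
  obtain ⟨δ, hδ, hδc⟩ := Metric.continuousWithinAt_iff.1 (h 0 _ hbt) (1 / 2) (by norm_num)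
  set m : ℝ := min 1 (t + δ / 2) with hm
  have hmt : t < m := lt_min (lt_of_le_of_ne ht1 (by
      intro h1; rw [h1] at ht2; norm_num at ht2)) (by linarith)
  have hm0 : 0 < m := ht0.trans hmt
  have hm1 : m ≤ 1 := min_le_left _ _
  have hbm : (fun _ : Fin 1 => m) ∈ Box 1 0 := mem_box.2 fun _ => ⟨hm0, hm1⟩
  have hdist : dist (fun _ : Fin 1 => m) (fun _ : Fin 1 => t) < δ := by
    refine (dist_pi_lt_iff hδ).2 fun _ => ?_
    rw [Real.dist_eq, abs_of_nonneg (by linarith)]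
    have : m ≤ t + δ / 2 := min_le_right _ _
    linarith
  have hfm : βsep 0 (fun _ => m) = 2 := by
    have hm2 : 2 / 3 < m ^ 2 := by rw [← ht2]; exact pow_lt_pow_left₀ hmt ht0.le two_ne_zero
    have hlt : 1 / m ^ 2 < 3 / 2 := by
      rw [div_lt_iff₀ (by positivity)]; linarith
    have hp : 1 / m ^ 2 < 3 / 2 ∧ (fun _ : Fin 1 => m) (Fin.last 0) ≠ 0 := ⟨hlt, hm0.ne'⟩
    show 1 + (if 1 / m ^ 2 < 3 / 2 ∧ (fun _ : Fin 1 => m) (Fin.last 0) ≠ 0 then (1 : ℝ) else 0) = 2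
    rw [if_pos hp]; norm_num
  have := hδc hbm hdist
  rw [hfm, hft, Real.dist_eq] at this
  norm_num at this

/-- **THE SEPARATION**: every β-side hypothesis of this line's stubs holds for `(βsep, Ssep)` with `γ₀ = b = 1`, `A = 1/2`,
`r = r′ = 1/4` (so `0 ≤ r ≤ b`, `0 ≤ r′`), while the birth line's box-wide `RemainderConst` (any `r < 1`) and box-wide `BetaContH` fail. -/
theorem classRoad_strictly_weaker :
    (OneLoopDrift 1 (1 / 2) Ssep.β0 ∧ InterScaleRemainder Ssep 1 1 (1 / 2) (1 / 4) (1 / 4) ∧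
        BetaContOnInterScale βsep 1 1 (1 / 2) (1 / 4) (1 / 4)) ∧
      (∀ r < 1, ¬ Beta.RemainderChain.RemainderConst Ssep 1 r) ∧ ¬ FlowStep.BetaContH 1 βsep :=
  ⟨⟨oneLoopDrift_sep, interScaleRemainder_sep, betaContOnInterScale_sep⟩, fun _ hr => not_remainderConst_sep hr,
    not_betaContH_sep⟩

end Separation

end Summit.QuantumFields.YangMills.Cruxes.EndpointGivenB.ClassRoad

end

/-! ## Audit: the composition concludes the crux BY NAME; axioms of the sorry-free theorems (the two `stub_*` are the only sorries). -/
#print axioms Summit.QuantumFields.YangMills.Cruxes.EndpointGivenB.ClassRoad.EndpointGivenB_of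
#print axioms Summit.QuantumFields.YangMills.Cruxes.EndpointGivenB.ClassRoad.endpointWithin_of
#print axioms Summit.QuantumFields.YangMills.Cruxes.EndpointGivenB.ClassRoad.classStubs_of_birthStubs
#print axioms Summit.QuantumFields.YangMills.Cruxes.EndpointGivenB.ClassRoad.classRoad_strictly_weaker

/-- The composition's type, restated with fully qualified names (elaboration = the check). -/
example :
    (∀ F : Literature.MathematicalPhysics.QuantumFieldTheory.Balaban1983to89.T4Continuum.T4Family,
      (∃ D : Literature.MathematicalPhysics.QuantumFieldTheory.Balaban1983to89.T4Continuum.FiniteEpsData F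
          (Matrix.specialUnitaryGroup (Fin 2) ℂ), Summit.QuantumFields.YangMills.Cruxes.EndpointGivenB.ClassRoad.RungB D) →
      ∃ (D : Literature.MathematicalPhysics.QuantumFieldTheory.Balaban1983to89.T4Continuum.FiniteEpsData F
          (Matrix.specialUnitaryGroup (Fin 2) ℂ))
        (S : Literature.MathematicalPhysics.QuantumFieldTheory.Balaban1983to89.B12Beta.OneLoopSplit D.βfun) (γ₀ b A r r' : ℝ),
        Summit.QuantumFields.YangMills.Cruxes.EndpointGivenB.ClassRoad.RungB D ∧
          Summit.QuantumFields.YangMills.Cruxes.EndpointGivenB.ClassRoad.ClassLaw D S γ₀ b A r r') →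
    (∀ F : Literature.MathematicalPhysics.QuantumFieldTheory.Balaban1983to89.T4Continuum.T4Family,
      (∃ (D : Literature.MathematicalPhysics.QuantumFieldTheory.Balaban1983to89.T4Continuum.FiniteEpsData F
          (Matrix.specialUnitaryGroup (Fin 2) ℂ))
        (S : Literature.MathematicalPhysics.QuantumFieldTheory.Balaban1983to89.B12Beta.OneLoopSplit D.βfun) (γ₀ b A r r' : ℝ),
        Summit.QuantumFields.YangMills.Cruxes.EndpointGivenB.ClassRoad.RungB D ∧
          Summit.QuantumFields.YangMills.Cruxes.EndpointGivenB.ClassRoad.ClassLaw D S γ₀ b A r r') →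
      ∃ (D : Literature.MathematicalPhysics.QuantumFieldTheory.Balaban1983to89.T4Continuum.FiniteEpsData F
          (Matrix.specialUnitaryGroup (Fin 2) ℂ))
        (S : Literature.MathematicalPhysics.QuantumFieldTheory.Balaban1983to89.B12Beta.OneLoopSplit D.βfun) (γ₀ b A r r' : ℝ),
        Summit.QuantumFields.YangMills.Cruxes.EndpointGivenB.ClassRoad.RungB D ∧
          Summit.QuantumFields.YangMills.Cruxes.EndpointGivenB.ClassRoad.ClassLaw D S γ₀ b A r r' ∧
            Summit.QuantumFields.YangMills.Cruxes.EndpointGivenB.ClassRoad.ClassCont D γ₀ b A r r') →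
    Summit.QuantumFields.YangMills.Theses.BalabanUVNodes.EndpointGivenB :=
  Summit.QuantumFields.YangMills.Cruxes.EndpointGivenB.ClassRoad.EndpointGivenB_of

/-! ## §7 REGISTRATION FORM (line-writer seat `linewriter-ym-nodeo-1` g0, operator priority28, 2026-08-31 — ADDITIVE to ym-nodeO-ideate LENS P3's file of 2026-08-25;
§1–§6 unchanged except that `EndpointGivenB_of`'s two binders are now TYPED BY NAME `Registered.stub_classLawAtRecord ∕ Registered.stub_classContAtRecord` = the stub statements
verbatim as reducible abbreviations): the ONE zero-hypothesis theorem concluding the crux BY NAME from the two `stub_*`, so that `ledger skeleton check … --crux stmt-QuantumFields-19181`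
registers `stub_classLawAtRecord`, `stub_classContAtRecord` on ⟨19181⟩ (aside, rank 2; AS TYPED junk-closable by the flat Stage-0 witness ✓p409380∕✓p409394 — and the
Stage-0-pinned stubs of §4 inherit that misstatement: a placeholder datum with a zero one-loop split plausibly meets `RungB ∧ ClassLaw ∧ ClassCont`; DO NOT close them by a placeholder —
their honest edition is §8, the SAME two stubs at the Ax datum of record, whose β-family is Bałaban's β of record).  HONEST: supply for hands, not progress; nothing of Bałaban proved;
NODE O not advanced; YM mass gap NOT proved. -/
theorem Summit.QuantumFields.YangMills.Cruxes.EndpointGivenB.ClassRoad.endpointGivenB_of_classRoadStubs :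
    Summit.QuantumFields.YangMills.Theses.BalabanUVNodes.EndpointGivenB :=
  Summit.QuantumFields.YangMills.Cruxes.EndpointGivenB.ClassRoad.EndpointGivenB_of
    Summit.QuantumFields.YangMills.Cruxes.EndpointGivenB.ClassRoad.stub_classLawAtRecord
    Summit.QuantumFields.YangMills.Cruxes.EndpointGivenB.ClassRoad.stub_classContAtRecord

/-! ## §8 THE AX EDITION (line-writer seat `linewriter-ym-nodeo-1` g0, 2026-08-31): the CLASS ROAD RE-PINNED AT THE LIVE (Ax) RECORD — `EndpointGivenB` ⟨stmt-QuantumFields-19181⟩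
# (line-writer seat `linewriter-ym-nodeo-1` g0, operator priority28, 2026-08-31) · route `route-QuantumFields-BalabanUVNodes` (rev 38) · aside (rank 2; rev-0 Stage-0 text; HOLD E1)

WHY THIS SECTION.  The class-road line above (§1–§7; ym-nodeO-ideate LENS P3, 2026-08-25; registration form by this seat) types NODE O's endpoint crux in the β-currency in
which print constructs anything (one-loop DRIFT + the second-order remainder `−r ≤ β¹ ≤ r′` and continuity asked ONLY on the members of the inter-scale tube pinned at the
target coupling; Brouwer fixed point of the backward map — socket `ClassRoad.endpointExistence_of_interScaleRemainder_contOn`, sorry-free).  Its two stubs, however, are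
posed at a STAGE-0 datum of record (`ClassRoad.RungB D` = `IsDatumOfRecord₀ ∧ (B) ∧ window`), and at Stage 0 that hypothesis — and the item itself — is JUNK-SATISFIABLE
(the flat datum: `BalabanUVNodesStage0FlatWitness.exists_isDatumOfRecord₀_endStatementBPrinted_endpoint` ✓p409394 is VERBATIM the item's conclusion; hold E1 «misstated at
Stage 0»).  This section keeps the class road's socket and its two β-side notions (`ClassRoad.ClassLaw`, `ClassRoad.ClassCont`) UNCHANGED and re-poses the two stubs at THE
DATUM OF RECORD of the live pin — `Node00.datumOfRecord₁₃SepCoPHVAx F 2 θ h v` of an admissible σ∕choice-free Stage-13 tuple (K0ᴬ ⟨27238⟩, by name; K1ᴬ ⟨27239⟩'s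
`∃ θ h v` currency), whose β-family is the record's `Node00.betaOfRecord₁₃Ax` (`Node00.βfun_datumOfRecord₁₃SepCoPHVAx`, `rfl`) and NOT a placeholder.  So the registered stubs
of ⟨19181⟩ now carry content no flat witness meets: «one-loop drift + (D4) on the pinned inter-scale classes FOR BAŁABAN'S β OF RECORD» and «(C) on those classes for the same β».

CONTENTS.  §8.1 the two Ax stubs (closed `∃ → ∃` shape, stub 2 chained after stub 1, exactly as §4's) + their registration names; §8.2 the kernel-checked composition
`EndpointGivenB_ofAx : K0ᴬ → stub₁ → stub₂ → EndpointGivenB` BY NAME through the class road's socket (forward generation = the datum's own field `.fwd`; Stage-0 face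
`Node00.isDatumOfRecord₀_datumOfRecord₁₃SepCoPHVAx`, `rfl`; the item's Stage-0 hypothesis is discarded — it carries no information) and the zero-extra-hypothesis concluder
`endpointGivenB_of_axClassRoad (h0 : K0ᴬ)`; §8.3 RE-PIN CERTIFICATE (kernel): given K0ᴬ, the Ax stubs imply the class road's Stage-0 registered stub statements
(`stage0Law_of_ax`, `stage0Cont_of_ax`) — the Ax edition is the stronger, non-vacuous reading of the same line.
NOT CERTIFIED (and not claimed): that the live cone K1ᴬ ∧ K3ᴬ implies these stubs — the class law is a DIFFERENT β-side currency from K1ᴬ's run rows (i)(iv)(C) (neither is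
known to imply the other in the tree); the endpoint itself follows from the rows by K2ᴬ ✓, so for the route's `closes` this line is an ALTERNATIVE road to the endpoint, banked on
the aside ⟨19181⟩, whose value is the weaker β-side ask (no `BetaUpperH`, no lower β-bound, no box-wide (D4)∕(C), `r ≤ b` not `b∕4`).

TWO more `sorry`s (the Ax stubs; four in the file).  HONEST LABEL: supply for hands, not progress; ⟨19181⟩ stays an ASIDE on hold; nothing of Bałaban proved; NODE O not advanced ([Balaban1987RG1] Thm 2
p.259 unproved in print and here); `closes` reaches only the CONDITIONAL finite-𝕋⁴ rung `BalabanLadder.UV` (R4) at fixed ε; NOT ℝ⁴ ∕ OS ∕ Clay — the Yang–Mills mass gap is NOT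
proved by any of this.  Print loci: [I] = Balaban1987RG1: (0.17)–(0.20) pp.255–256, Thm 2 p.259, (1.19)–(1.22) pp.263–264; [III] = Balaban1988Convergent (2.4)–(2.9) pp.255–256.
-/

noncomputable section

open Literature.MathematicalPhysics.QuantumFieldTheory.Balaban1983to89
open Literature.MathematicalPhysics.QuantumFieldTheory.Balaban1983to89.T4Continuum
open Summit.QuantumFields.YangMills.Cruxes.EndpointGivenB

namespace Summit.QuantumFields.YangMills.Cruxes.EndpointGivenB.ClassRoadAx

/-! ### §8.1 The two stubs at the Ax datum of record -/

/-- **STUB 1 «class law at an admissible Ax record»**: for every family with an admissible σ∕choice-free Stage-13 tuple, SOME admissible `(θ, h, v)` whose datum of record carries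
(B) + the window (`ClassRoad.RungB`, its `IsDatumOfRecord₀` face being `rfl`) AND a one-loop split `S` of its β-family `= Node00.betaOfRecord₁₃Ax` with data `(γ₀, b, A, r, r′)`
obeying the CLASS LAW (`ClassRoad.ClassLaw`: history-free drift `|Σ_{j<k} β⁰_j − b k| ≤ A`; `−r ≤ β¹_{k+1} ≤ r′` on the prefix histories of members of every admissibly pinned
inter-scale tube; `0 < γ₀`, `0 ≤ r ≤ b`, `0 ≤ r′`).  RESEARCH ([I] Thm 2's β-side input restricted to (2.6)-class histories: NODE O through the (D4) slice, pointwise in `(k, p)`);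
(B)+window is K1ᴬ's content ([V] Thm 1, [I] Thm 2 window).  Size L. -/
theorem stub_classLawAtAxRecord :
    ∀ F : T4Family, (∃ θ : Node00.Stage13HParams F 2, θ.Provisos₁₃SepCoPHAx F 2 ∧ (θ.ZhUnity F 2 ∧ θ.SlotsNondegenerate₁₃Ax F 2) ∧ θ.Admissible F 2) →
      ∃ (θ : Node00.Stage13HParams F 2) (h : θ.Provisos₁₃SepCoPHAx F 2) (v : Node00.Revision₁₃Ax F 2 θ h),
        (θ.ZhUnity F 2 ∧ θ.SlotsNondegenerate₁₃Ax F 2) ∧ θ.Admissible F 2 ∧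
        ClassRoad.RungB (Node00.datumOfRecord₁₃SepCoPHVAx F 2 θ h v) ∧
        ∃ (S : B12Beta.OneLoopSplit (Node00.datumOfRecord₁₃SepCoPHVAx F 2 θ h v).βfun) (γ₀ b A r r' : ℝ),
          ClassRoad.ClassLaw (Node00.datumOfRecord₁₃SepCoPHVAx F 2 θ h v) S γ₀ b A r r' := by
  sorry

/-- **STUB 2 «(C) on the class at that Ax record»** (chained after stub 1, closed `∃ → ∃`: the prover may re-choose the tuple and shrink the data): continuity of the record's
β-family on the member histories of the admissibly pinned inter-scale tubes (`ClassRoad.ClassCont`), together with stub 1's package.  PRINT-ish ([I] (1.22) p.264 «C^∞-function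
of g_{j−1} ∈ [0, γ]» read on the class; the class-phrased M-test of the LENS P3 companion §E.9).  Size M. -/
theorem stub_classContAtAxRecord :
    ∀ F : T4Family, (∃ (θ : Node00.Stage13HParams F 2) (h : θ.Provisos₁₃SepCoPHAx F 2) (v : Node00.Revision₁₃Ax F 2 θ h),
        (θ.ZhUnity F 2 ∧ θ.SlotsNondegenerate₁₃Ax F 2) ∧ θ.Admissible F 2 ∧
        ClassRoad.RungB (Node00.datumOfRecord₁₃SepCoPHVAx F 2 θ h v) ∧
        ∃ (S : B12Beta.OneLoopSplit (Node00.datumOfRecord₁₃SepCoPHVAx F 2 θ h v).βfun) (γ₀ b A r r' : ℝ),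
          ClassRoad.ClassLaw (Node00.datumOfRecord₁₃SepCoPHVAx F 2 θ h v) S γ₀ b A r r') →
      ∃ (θ : Node00.Stage13HParams F 2) (h : θ.Provisos₁₃SepCoPHAx F 2) (v : Node00.Revision₁₃Ax F 2 θ h),
        (θ.ZhUnity F 2 ∧ θ.SlotsNondegenerate₁₃Ax F 2) ∧ θ.Admissible F 2 ∧
        ClassRoad.RungB (Node00.datumOfRecord₁₃SepCoPHVAx F 2 θ h v) ∧
        ∃ (S : B12Beta.OneLoopSplit (Node00.datumOfRecord₁₃SepCoPHVAx F 2 θ h v).βfun) (γ₀ b A r r' : ℝ),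
          ClassRoad.ClassLaw (Node00.datumOfRecord₁₃SepCoPHVAx F 2 θ h v) S γ₀ b A r r' ∧
          ClassRoad.ClassCont (Node00.datumOfRecord₁₃SepCoPHVAx F 2 θ h v) γ₀ b A r r' := by
  sorry

/-- Registration name of stub 1 (statement verbatim, reducible, NAMED LIKE THE STUB — makes the composition's binders admissible for `#h21_check_skeleton` rule (ii)). -/
abbrev Registered.stub_classLawAtAxRecord : Prop :=
  ∀ F : T4Family, (∃ θ : Node00.Stage13HParams F 2, θ.Provisos₁₃SepCoPHAx F 2 ∧ (θ.ZhUnity F 2 ∧ θ.SlotsNondegenerate₁₃Ax F 2) ∧ θ.Admissible F 2) →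
      ∃ (θ : Node00.Stage13HParams F 2) (h : θ.Provisos₁₃SepCoPHAx F 2) (v : Node00.Revision₁₃Ax F 2 θ h),
        (θ.ZhUnity F 2 ∧ θ.SlotsNondegenerate₁₃Ax F 2) ∧ θ.Admissible F 2 ∧
        ClassRoad.RungB (Node00.datumOfRecord₁₃SepCoPHVAx F 2 θ h v) ∧
        ∃ (S : B12Beta.OneLoopSplit (Node00.datumOfRecord₁₃SepCoPHVAx F 2 θ h v).βfun) (γ₀ b A r r' : ℝ),
          ClassRoad.ClassLaw (Node00.datumOfRecord₁₃SepCoPHVAx F 2 θ h v) S γ₀ b A r r'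

/-- Registration name of stub 2 (statement verbatim, reducible). -/
abbrev Registered.stub_classContAtAxRecord : Prop :=
  ∀ F : T4Family, (∃ (θ : Node00.Stage13HParams F 2) (h : θ.Provisos₁₃SepCoPHAx F 2) (v : Node00.Revision₁₃Ax F 2 θ h),
        (θ.ZhUnity F 2 ∧ θ.SlotsNondegenerate₁₃Ax F 2) ∧ θ.Admissible F 2 ∧
        ClassRoad.RungB (Node00.datumOfRecord₁₃SepCoPHVAx F 2 θ h v) ∧
        ∃ (S : B12Beta.OneLoopSplit (Node00.datumOfRecord₁₃SepCoPHVAx F 2 θ h v).βfun) (γ₀ b A r r' : ℝ),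
          ClassRoad.ClassLaw (Node00.datumOfRecord₁₃SepCoPHVAx F 2 θ h v) S γ₀ b A r r') →
      ∃ (θ : Node00.Stage13HParams F 2) (h : θ.Provisos₁₃SepCoPHAx F 2) (v : Node00.Revision₁₃Ax F 2 θ h),
        (θ.ZhUnity F 2 ∧ θ.SlotsNondegenerate₁₃Ax F 2) ∧ θ.Admissible F 2 ∧
        ClassRoad.RungB (Node00.datumOfRecord₁₃SepCoPHVAx F 2 θ h v) ∧
        ∃ (S : B12Beta.OneLoopSplit (Node00.datumOfRecord₁₃SepCoPHVAx F 2 θ h v).βfun) (γ₀ b A r r' : ℝ),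
          ClassRoad.ClassLaw (Node00.datumOfRecord₁₃SepCoPHVAx F 2 θ h v) S γ₀ b A r r' ∧
          ClassRoad.ClassCont (Node00.datumOfRecord₁₃SepCoPHVAx F 2 θ h v) γ₀ b A r r'

/-! ### §8.2 Composition BY NAME through the class road's socket -/

/-- **★ `EndpointGivenB` from K0ᴬ (by name) and the two Ax stubs (by their registration names)** — the datum is the Ax datum of record, endpoint existence is the class road's
Brouwer socket `ClassRoad.endpointExistence_of_interScaleRemainder_contOn` fed with the datum's own forward generation `.fwd`; no `sorry` here; the item's Stage-0 hypothesis
is not used. -/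
theorem EndpointGivenB_ofAx (h0 : Summit.QuantumFields.YangMills.Theses.BalabanUVNodes.Record13SepCoPHInhabitedAx)
    (h₁ : Registered.stub_classLawAtAxRecord) (h₂ : Registered.stub_classContAtAxRecord) :
    Summit.QuantumFields.YangMills.Theses.BalabanUVNodes.EndpointGivenB := by
  intro F _
  obtain ⟨θ, h, v, -, -, ⟨hrec, hB, -⟩, S, γ₀, b, A, r, r', ⟨hγ₀, h0r, hrb, h0r', hdrift, hrem⟩, hcont⟩ := h₂ F (h₁ F (h0 F))
  exact ⟨Node00.datumOfRecord₁₃SepCoPHVAx F 2 θ h v, hrec, hB,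
    ClassRoad.endpointExistence_of_interScaleRemainder_contOn (Node00.datumOfRecord₁₃SepCoPHVAx F 2 θ h v).fwd S hγ₀ h0r hrb h0r' hdrift hcont hrem⟩

/-- **★ THE SKELETON THEOREM — `EndpointGivenB` from the live cone's K0ᴬ ⟨27238⟩ (OPEN route item, by name) and the TWO registered Ax stubs.** -/
theorem endpointGivenB_of_axClassRoad (h0 : Summit.QuantumFields.YangMills.Theses.BalabanUVNodes.Record13SepCoPHInhabitedAx) :
    Summit.QuantumFields.YangMills.Theses.BalabanUVNodes.EndpointGivenB :=
  EndpointGivenB_ofAx h0 stub_classLawAtAxRecord stub_classContAtAxRecord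

/-! ### §8.3 Re-pin certificate (kernel): given K0ᴬ, the Ax stubs imply §4's Stage-0 stub statements -/

/-- Ax stub 1 + K0ᴬ ⇒ the class road's Stage-0 stub 1 statement (`ClassRoad.Registered.stub_classLawAtRecord`): take the Ax datum of record. -/
theorem stage0Law_of_ax (h0 : Summit.QuantumFields.YangMills.Theses.BalabanUVNodes.Record13SepCoPHInhabitedAx) (h₁ : Registered.stub_classLawAtAxRecord) :
    ClassRoad.Registered.stub_classLawAtRecord := by
  intro F _
  obtain ⟨θ, h, v, -, -, hR, S, γ₀, b, A, r, r', hL⟩ := h₁ F (h0 F)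
  exact ⟨_, S, γ₀, b, A, r, r', hR, hL⟩

/-- Ax stubs 1 + 2 + K0ᴬ ⇒ the class road's Stage-0 stub 2 statement (`ClassRoad.Registered.stub_classContAtRecord`). -/
theorem stage0Cont_of_ax (h0 : Summit.QuantumFields.YangMills.Theses.BalabanUVNodes.Record13SepCoPHInhabitedAx) (h₁ : Registered.stub_classLawAtAxRecord)
    (h₂ : Registered.stub_classContAtAxRecord) : ClassRoad.Registered.stub_classContAtRecord := by
  intro F _
  obtain ⟨θ, h, v, -, -, hR, S, γ₀, b, A, r, r', hL, hC⟩ := h₂ F (h₁ F (h0 F))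
  exact ⟨_, S, γ₀, b, A, r, r', hR, hL, hC⟩

/-- Hence the class road's OWN composition also concludes the item from the Ax stubs (second kernel path; same theorem `ClassRoad.EndpointGivenB_of`). -/
theorem endpointGivenB_of_ax_via_stage0 (h0 : Summit.QuantumFields.YangMills.Theses.BalabanUVNodes.Record13SepCoPHInhabitedAx)
    (h₁ : Registered.stub_classLawAtAxRecord) (h₂ : Registered.stub_classContAtAxRecord) :
    Summit.QuantumFields.YangMills.Theses.BalabanUVNodes.EndpointGivenB :=
  ClassRoad.EndpointGivenB_of (stage0Law_of_ax h0 h₁) (stage0Cont_of_ax h0 h₁ h₂)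

end Summit.QuantumFields.YangMills.Cruxes.EndpointGivenB.ClassRoadAx

end
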